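import Literature.Barriers.Parity.SiegelZeroDichotomyChowlaStep3PrimePow
import Literature.Barriers.Parity.SiegelZeroDichotomyChowlaStep3Blocks
import Literature.Barriers.Parity.SiegelZeroDichotomyChowlaStep3Flat
import Literature.NumberTheory.Sieve.BombieriAsymptoticSieveSmoothPart
import HarnessLib

/-!
# Step (iii) of Tao–Teräväinen at `k = 0`: the short-divisor-sum majorant
# `|β_s(n)| ≤ Σ_{d ∣ n, d ≤ D} v_s(d)`

Topic `Literature/Barriers/Parity`, sub-namespace `TaoTeravainen`; a file of the proof DAG of
`Literature.Barriers.Parity.TaoTeravainen2021_chowla`, towards `TaoTeravainen2021_lemma61`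
(Lemma 6.1). Everything here is PROVED.

In the proof of Lemma 6.1 the source obtains, after Landreau's splitting, "for some `i = 1,…,m`.
In particular, we see that
`|β_t| ∗ 1_(>R)(n) ≪ Σ_{d ≤ D: d ∣ n} 1_(≤R)(d) Π_{p≤R} (exp(O(a_{t,d_(p)})) - 1)`.
We therefore obtain the bound (6.4) with
`α(d) := 1_(≤R)(d) ∫_ℝ Π_{p ≤ R}(exp(O(a_{t,d_(p)})) - 1) |f(t)| dt`."
[cite: TaoTeravainen2021, §6, proof of Lemma 6.1 (the displays before (6.6)'s proof)]

Here, with `bExp` (`SiegelZeroDichotomyChowlaStep3PrimePow.lean`), the block inequality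
(`SiegelZeroDichotomyChowlaStep3Blocks.lean`) and `‖β_s(n)‖ = Π_{p^k ∥ n} ‖β_s(p^k)‖`
(`SiegelZeroDichotomyChowlaStep3Flat.lean`):

* `prodPow S e = Π_{p ∈ S} p^{e p}` with its factorisation (the `ℕ_(<N)`-part `smoothPart N n` of `n`
  is the tree's `Literature.NumberTheory.Sieve.smoothPart`);
* `norm_betaAF_le_exp_expSum` — `‖β_s(n)‖ ≤ exp(expSum (bExp s) (smoothPart N n))`, `N = ⌊R⌋₊ + 1`
  (the factors at `p > R` are `≤ 1`, those at `p ≤ R` are `≤ e^{bExp}`);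
* `vMaj s P N d = 1_{ℕ_(<N)}(d) Π_{p^k ∥ d} (exp(P · bExp s p k) - 1) ≥ 0` — the source's
  `1_(≤R)(d) Π_p (exp(O(a_{t,d_(p)})) - 1)` with the `O`-constant `P = J 4^{J-1}` — and the
  expansion `exp_expSum_pow_le_sum_vMaj`: `exp(expSum (bExp s) d)^P ≤ Σ_{d' ∣ d} vMaj s P N d'`
  for `ℕ_(<N)`-smooth `d` (`Π (1 + c_p) = Σ_{S} Π_{p ∈ S} c_p`, `Finset.prod_one_add`);
* **`norm_betaAF_le_sum_vMaj`** — `‖β_s(n)‖ ≤ Σ_{d ∣ n, d ≤ D'} vMaj s P N d` for `n ≥ 1` with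
  `log n ≤ (J-1) log(D'/⌊R⌋₊)` (`R ≥ 1`, `Re s ≥ 0`, `(Re s) log R ≤ 1`).
  [cite: TaoTeravainen2021, §6, proof of Lemma 6.1]
-/

noncomputable section

open Finset Real
open Literature.NumberTheory.Sieve (smoothPart smoothPart_ne_zero factorization_smoothPart smoothPart_dvd
  smoothPart_mem_smoothNumbers)

namespace Literature.Barriers.Parity.TaoTeravainen

/-! ### Products of prime powers with prescribed exponents; the smooth part -/

/-- `prodPow S e = Π_{p ∈ S} p^{e p}`. [folklore] -/
def prodPow (S : Finset ℕ) (e : ℕ → ℕ) : ℕ := ∏ p ∈ S, p ^ e p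

/-- `prodPow S e ≠ 0` for a set of primes `S`. [folklore] -/
theorem prodPow_ne_zero {S : Finset ℕ} (hS : ∀ p ∈ S, p.Prime) (e : ℕ → ℕ) : prodPow S e ≠ 0 :=
  Finset.prod_ne_zero_iff.mpr fun p hp => pow_ne_zero _ (hS p hp).ne_zero

/-- The factorisation of `prodPow S e` (primes `S`). [folklore] -/
theorem factorization_prodPow {S : Finset ℕ} (hS : ∀ p ∈ S, p.Prime) (e : ℕ → ℕ) (r : ℕ) :
    (prodPow S e).factorization r = if r ∈ S then e r else 0 := by
  classical
  unfold prodPow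
  rw [Nat.factorization_prod fun p hp => pow_ne_zero _ (hS p hp).ne_zero, Finset.sum_apply']
  have : ∀ p ∈ S, (p ^ e p).factorization r = if p = r then e p else 0 := by
    intro p hp
    rw [(hS p hp).factorization_pow, Finsupp.single_apply]
  rw [Finset.sum_congr rfl this, Finset.sum_ite_eq']

/-- The prime factors of `prodPow S e` are `S` when all `e p ≥ 1` on `S`. [folklore] -/
theorem primeFactors_prodPow {S : Finset ℕ} (hS : ∀ p ∈ S, p.Prime) {e : ℕ → ℕ}
    (he : ∀ p ∈ S, e p ≠ 0) : (prodPow S e).primeFactors = S := by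
  ext r
  rw [← Nat.support_factorization, Finsupp.mem_support_iff, factorization_prodPow hS e r]
  constructor
  · intro h; by_contra hr; rw [if_neg hr] at h; exact h rfl
  · intro hr; rw [if_pos hr]; exact he r hr

/-- `prodPow S e ∣ d` if `S ⊆ primes` and `e p ≤ v_p(d)` on `S` (`d ≠ 0`). [folklore] -/
theorem prodPow_dvd {S : Finset ℕ} (hS : ∀ p ∈ S, p.Prime) {e : ℕ → ℕ} {d : ℕ} (hd : d ≠ 0)
    (he : ∀ p ∈ S, e p ≤ d.factorization p) : prodPow S e ∣ d := by
  rw [← Nat.factorization_le_iff_dvd (prodPow_ne_zero hS e) hd]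
  intro r
  rw [factorization_prodPow hS e r]
  split_ifs with hr
  · exact he r hr
  · exact Nat.zero_le _

/-! ### The smooth part (reusing `Literature.NumberTheory.Sieve.smoothPart`) -/

/-- The prime factors of the smooth part `smoothPart N n = Π_{p ∣ n, p < N} p^{v_p(n)}` (the
source's `n_(≤R)` with `N = ⌊R⌋₊ + 1`; the definition and its basic API are the tree's
`Literature.NumberTheory.Sieve.smoothPart`). [cite: TaoTeravainen2021, §2.2] -/
theorem primeFactors_smoothPart (N n : ℕ) :
    (smoothPart N n).primeFactors = n.primeFactors.filter (· < N) := by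
  ext p
  rw [← Nat.support_factorization, Finsupp.mem_support_iff, factorization_smoothPart, Finset.mem_filter,
    ← Nat.support_factorization, Finsupp.mem_support_iff]
  by_cases hpN : p < N
  · simp [hpN]
  · simp [hpN]

variable {q : ℕ} (χ : DirichletCharacter ℂ q)

/-! ### `‖β_s(n)‖ ≤ exp(expSum (bExp s) (smoothPart N n))` -/

/-- `p < ⌊R⌋₊ + 1` iff `p ≤ R` for `p ≥ 1`, `R ≥ 0` (the sibling file's `lt_floor_add_one_iff`).
[folklore] -/
theorem le_of_lt_floor_add_one {p : ℕ} (hp : 1 ≤ p) {R : ℝ} (h : p < ⌊R⌋₊ + 1) : (p : ℝ) ≤ R :=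
  (lt_floor_add_one_iff hp R).mp h

/-- **`‖β_s(n)‖ ≤ exp(Σ_{p ∣ n, p ≤ R} bExp(s, p, v_p(n)))`** for `n ≥ 1`, `R ≥ 1`, `Re s ≥ 0`,
quadratic `χ` ("The function `|β_t|` is multiplicative … `|β_t| ∗ 1_(>R)(n) ≪ Π_{p≤R} |β_t(n_(p))|`
… `≤ exp(O(Σ_{p ≤ R} a_{t,n_(p)}))`"). [cite: TaoTeravainen2021, §6, proof of Lemma 6.1] -/
theorem norm_betaAF_le_exp_expSum (hχ : χ.IsQuadratic) (R : ℝ) {s : ℂ}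
    (hs : 0 ≤ s.re) {n : ℕ} (hn : n ≠ 0) :
    ‖betaAF χ (⌊R⌋₊ + 1) s n‖ ≤ Real.exp (expSum (bExp s) (smoothPart (⌊R⌋₊ + 1) n)) := by
  classical
  set N := ⌊R⌋₊ + 1 with hN
  rw [norm_betaAF_eq_prod χ hχ N s hn, ← Finset.prod_filter_mul_prod_filter_not n.primeFactors (· < N)]
  -- primes `p > R` contribute factors `≤ 1`
  have hbig : ∏ p ∈ n.primeFactors.filter (fun p => ¬ p < N), ‖betaAF χ N s (p ^ n.factorization p)‖ ≤ 1 := by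
    refine Finset.prod_le_one (fun _ _ => norm_nonneg _) fun p hp => ?_
    rw [Finset.mem_filter] at hp
    exact norm_betaAF_prime_pow_le_one χ hχ s (Nat.prime_of_mem_primeFactors hp.1) (not_lt.mp hp.2) _
  -- primes `p ≤ R` contribute `≤ e^{bExp}`
  have hsmall : ∏ p ∈ n.primeFactors.filter (· < N), ‖betaAF χ N s (p ^ n.factorization p)‖ ≤
      ∏ p ∈ n.primeFactors.filter (· < N), Real.exp (bExp s p (n.factorization p)) := by
    refine Finset.prod_le_prod (fun _ _ => norm_nonneg _) fun p hp => ?_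
    rw [Finset.mem_filter] at hp
    have hprime := Nat.prime_of_mem_primeFactors hp.1
    exact norm_betaAF_prime_pow_le_exp_bExp χ hχ hprime (le_of_lt_floor_add_one hprime.one_lt.le hp.2) hs _
  have hexp : ∏ p ∈ n.primeFactors.filter (· < N), Real.exp (bExp s p (n.factorization p)) =
      Real.exp (expSum (bExp s) (smoothPart N n)) := by
    rw [← Real.exp_sum, expSum, primeFactors_smoothPart]
    congr 1
    refine Finset.sum_congr rfl fun p hp => ?_
    rw [factorization_smoothPart, if_pos (Finset.mem_filter.mp hp).2]
  calc (∏ p ∈ n.primeFactors.filter (· < N), ‖betaAF χ N s (p ^ n.factorization p)‖) *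
        ∏ p ∈ n.primeFactors.filter (fun p => ¬ p < N), ‖betaAF χ N s (p ^ n.factorization p)‖
      ≤ (∏ p ∈ n.primeFactors.filter (· < N), Real.exp (bExp s p (n.factorization p))) * 1 :=
        mul_le_mul hsmall hbig (Finset.prod_nonneg fun _ _ => norm_nonneg _)
          (Finset.prod_nonneg fun _ _ => (Real.exp_pos _).le)
    _ = Real.exp (expSum (bExp s) (smoothPart N n)) := by rw [mul_one, hexp]

/-! ### The majorant `vMaj` and the expansion of `exp(expSum)^P` -/

/-- The majorant weight (the source's `1_(≤R)(d) Π_{p} (exp(O(a_{t,d_(p)})) - 1)` with the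
`O`-constant `P`): `vMaj s P N d = 1_{ℕ_(<N)}(d) Π_{p ∣ d} (exp(P · bExp(s, p, v_p(d))) - 1)`.
[cite: TaoTeravainen2021, §6, proof of Lemma 6.1 (definition of `α(d)`)] -/
def vMaj (s : ℂ) (P N d : ℕ) : ℝ :=
  if d ∈ N.smoothNumbers then
    ∏ p ∈ d.primeFactors, (Real.exp (P * bExp s p (d.factorization p)) - 1)
  else 0

/-- `vMaj ≥ 0` (`Re s ≥ 0`). [folklore] -/
theorem vMaj_nonneg {s : ℂ} (hs : 0 ≤ s.re) (P N d : ℕ) : 0 ≤ vMaj s P N d := by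
  unfold vMaj
  split_ifs
  · refine Finset.prod_nonneg fun p _ => ?_
    have : 0 ≤ (P : ℝ) * bExp s p (d.factorization p) := mul_nonneg (Nat.cast_nonneg _) (bExp_nonneg hs _ _)
    linarith [Real.add_one_le_exp ((P : ℝ) * bExp s p (d.factorization p))]
  · exact le_rfl

/-- `vMaj` at a prime-power product: for primes `S ⊆` the prime factors of a smooth `d`,
`vMaj (prodPow S v_d) = Π_{p ∈ S} (exp(P bExp(s,p,v_p d)) - 1)`. [folklore] -/
theorem vMaj_prodPow {s : ℂ} {P N d : ℕ} (hd : d ∈ N.smoothNumbers) {S : Finset ℕ}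
    (hS : S ⊆ d.primeFactors) :
    vMaj s P N (prodPow S d.factorization) =
      ∏ p ∈ S, (Real.exp (P * bExp s p (d.factorization p)) - 1) := by
  have hd0 : d ≠ 0 := Nat.ne_zero_of_mem_smoothNumbers hd
  have hSp : ∀ p ∈ S, p.Prime := fun p hp => Nat.prime_of_mem_primeFactors (hS hp)
  have hSe : ∀ p ∈ S, d.factorization p ≠ 0 := fun p hp => by
    have := hS hp
    rw [← Nat.support_factorization, Finsupp.mem_support_iff] at this
    exact this
  have hdvd : prodPow S d.factorization ∣ d := prodPow_dvd hSp hd0 fun p _ => le_rfl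
  have hsm : prodPow S d.factorization ∈ N.smoothNumbers := Nat.mem_smoothNumbers_of_dvd hd hdvd
  unfold vMaj
  rw [if_pos hsm, primeFactors_prodPow hSp hSe]
  refine Finset.prod_congr rfl fun p hp => ?_
  rw [factorization_prodPow hSp, if_pos hp]

/-- **Expansion**: for an `ℕ_(<N)`-smooth `d` and any finset `T` containing all divisors of `d`,
`exp(expSum (bExp s) d)^P ≤ Σ_{d' ∈ T} vMaj s P N d'` (`Π_p (1 + c_p) = Σ_{S ⊆ primes} Π_{p∈S} c_p`,
and `S ↦ Π_{p∈S} p^{v_p d}` is injective into the divisors of `d`; the other terms of the sum are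
`≥ 0`). [cite: TaoTeravainen2021, §6, proof of Lemma 6.1] -/
theorem exp_expSum_pow_le_sum_vMaj {s : ℂ} (hs : 0 ≤ s.re) {P N d : ℕ} (hd : d ∈ N.smoothNumbers)
    {T : Finset ℕ} (hT : ∀ d', d' ∣ d → d' ∈ T) :
    Real.exp (expSum (bExp s) d) ^ P ≤ ∑ d' ∈ T, vMaj s P N d' := by
  classical
  have hd0 : d ≠ 0 := Nat.ne_zero_of_mem_smoothNumbers hd
  set c : ℕ → ℝ := fun p => Real.exp (P * bExp s p (d.factorization p)) - 1 with hc
  -- `exp(expSum)^P = Π_p (1 + c p)`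
  have h1 : Real.exp (expSum (bExp s) d) ^ P = ∏ p ∈ d.primeFactors, (1 + c p) := by
    rw [← Real.exp_nat_mul, expSum, Finset.mul_sum, Real.exp_sum]
    refine Finset.prod_congr rfl fun p _ => ?_
    simp only [hc]; ring
  rw [h1, Finset.prod_one_add]
  -- each subset `S` of the prime factors gives the divisor `prodPow S v_d`
  set g : Finset ℕ → ℕ := fun S => prodPow S d.factorization with hg
  have hmemS : ∀ S ∈ d.primeFactors.powerset, (∀ p ∈ S, p.Prime) ∧ (∀ p ∈ S, d.factorization p ≠ 0) := by
    intro S hS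
    rw [Finset.mem_powerset] at hS
    refine ⟨fun p hp => Nat.prime_of_mem_primeFactors (hS hp), fun p hp => ?_⟩
    have := hS hp
    rw [← Nat.support_factorization, Finsupp.mem_support_iff] at this
    exact this
  have hginj : ∀ S ∈ d.primeFactors.powerset, ∀ S' ∈ d.primeFactors.powerset, g S = g S' → S = S' := by
    intro S hS S' hS' hSS'
    obtain ⟨hSp, hSe⟩ := hmemS S hS
    obtain ⟨hSp', hSe'⟩ := hmemS S' hS'
    have := congrArg Nat.primeFactors hSS'
    simp only [hg] at this
    rwa [primeFactors_prodPow hSp hSe, primeFactors_prodPow hSp' hSe'] at this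
  have hval : ∀ S ∈ d.primeFactors.powerset, ∏ p ∈ S, c p = vMaj s P N (g S) := by
    intro S hS
    rw [Finset.mem_powerset] at hS
    rw [hg]; dsimp only
    rw [vMaj_prodPow hd hS]
  rw [Finset.sum_congr rfl hval, ← Finset.sum_image hginj]
  refine Finset.sum_le_sum_of_subset_of_nonneg (fun d' hd' => ?_) (fun d' _ _ => vMaj_nonneg hs P N d')
  rw [Finset.mem_image] at hd'
  obtain ⟨S, hS, rfl⟩ := hd'
  obtain ⟨hSp, -⟩ := hmemS S hS
  exact hT _ (prodPow_dvd hSp hd0 fun p _ => le_rfl)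

/-! ### The main majorant inequality -/

/-- **`‖β_s(n)‖ ≤ Σ_{d ∣ n, d ≤ D'} vMaj s P N d`** (`N = ⌊R⌋₊ + 1`, `P = J 4^{J-1}`), for `n ≥ 1`,
`R ≥ 1`, `⌊R⌋₊ ≤ D'`, `1 < D'/⌊R⌋₊`, `log n ≤ (J-1) log(D'/⌊R⌋₊)`, `Re s ≥ 0`, `(Re s) log R ≤ 1`,
quadratic `χ` — the source's "`|β_t| ∗ 1_(>R)(n) ≪ Σ_{d ≤ D: d∣n} 1_(≤R)(d) Π_p (exp(O(a_{t,d_(p)})) - 1)`".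
[cite: TaoTeravainen2021, §6, proof of Lemma 6.1] -/
theorem norm_betaAF_le_sum_vMaj (hχ : χ.IsQuadratic) {R : ℝ} (hR : 1 ≤ R) {s : ℂ} (hs : 0 ≤ s.re)
    (hsR : s.re * Real.log R ≤ 1) {D' J : ℕ} (hJ : 1 ≤ J) (hBD : ⌊R⌋₊ ≤ D')
    (hDB : (1 : ℝ) < (D' : ℝ) / ⌊R⌋₊) {n : ℕ} (hn : n ≠ 0)
    (hlen : Real.log n ≤ ((J : ℝ) - 1) * Real.log ((D' : ℝ) / ⌊R⌋₊)) :
    ‖betaAF χ (⌊R⌋₊ + 1) s n‖ ≤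
      ∑ d ∈ n.divisors.filter (· ≤ D'), vMaj s (J * 4 ^ (J - 1)) (⌊R⌋₊ + 1) d := by
  classical
  set N := ⌊R⌋₊ + 1 with hN
  set m := smoothPart N n with hm
  have hm0 : m ≠ 0 := smoothPart_ne_zero N n
  have hmn : m ∣ n := smoothPart_dvd hn N
  have hB : 1 ≤ ⌊R⌋₊ := Nat.one_le_iff_ne_zero.mpr (by
    intro h; have := Nat.floor_eq_zero.mp h; linarith)
  -- the hypotheses of the block inequality for `a = bExp s`
  have ha : ∀ p k, 0 ≤ bExp s p k := fun p k => bExp_nonneg hs p k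
  have ha0 : ∀ p, bExp s p 0 = 0 := fun p => bExp_zero s p
  have hmsmooth : ∀ p, p.Prime → p ∣ m → p ≤ ⌊R⌋₊ := by
    intro p hp hpm
    have := (Nat.mem_smoothNumbers'.mp (smoothPart_mem_smoothNumbers N n)) p hp hpm
    omega
  -- subadditivity at the primes `p ≤ R` (the others never occur with `k₁, k₂ ≥ 1`… we need it for
  -- all primes: for `p` with `(Re s) log p ≤ 1` it is `bExp_add_le`; we restrict `a` accordingly)
  set a : ℕ → ℕ → ℝ := fun p k => if (p : ℝ) ≤ R then bExp s p k else 0 with ha_def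
  have ha' : ∀ p k, 0 ≤ a p k := fun p k => by
    simp only [ha_def]; split_ifs; exacts [ha p k, le_rfl]
  have ha0' : ∀ p, a p 0 = 0 := fun p => by simp only [ha_def]; split_ifs <;> simp
  have hsub' : ∀ p, p.Prime → ∀ k₁ k₂, 1 ≤ k₁ → 1 ≤ k₂ → a p (k₁ + k₂) ≤ 4 * (a p k₁ + a p k₂) := by
    intro p hp k₁ k₂ hk₁ hk₂
    simp only [ha_def]
    split_ifs with hpR
    · have hp1 : (1 : ℝ) ≤ p := by exact_mod_cast hp.one_lt.le
      have hlogp : Real.log p ≤ Real.log R := Real.log_le_log (by linarith) hpR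
      have hsp : s.re * Real.log p ≤ 1 :=
        (mul_le_mul_of_nonneg_left hlogp hs).trans hsR
      exact bExp_add_le hs hsp hk₁ hk₂
    · simp
  -- `expSum a = expSum (bExp s)` on divisors of `m` (all their primes are `≤ R`)
  have hexpSum : ∀ d, d ∣ m → expSum a d = expSum (bExp s) d := by
    intro d hdm
    unfold expSum
    refine Finset.sum_congr rfl fun p hp => ?_
    have hpm : p ∣ m := (Nat.dvd_of_mem_primeFactors hp).trans hdm
    have hpR : (p : ℝ) ≤ R := by
      have h1 := hmsmooth p (Nat.prime_of_mem_primeFactors hp) hpm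
      calc (p : ℝ) ≤ ⌊R⌋₊ := by exact_mod_cast h1
        _ ≤ R := Nat.floor_le (by linarith)
    simp only [ha_def, if_pos hpR]
  have hlenm : Real.log m ≤ ((J : ℝ) - 1) * Real.log ((D' : ℝ) / ⌊R⌋₊) := by
    refine le_trans (Real.log_le_log (by exact_mod_cast Nat.pos_of_ne_zero hm0) ?_) hlen
    exact_mod_cast Nat.le_of_dvd (Nat.pos_of_ne_zero hn) hmn
  obtain ⟨d₀, hd₀m, hd₀D, hblock⟩ :=
    exists_exp_expSum_le ha' ha0' hsub' hB hBD hDB hJ hm0 hmsmooth hlenm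
  rw [hexpSum m dvd_rfl, hexpSum d₀ hd₀m] at hblock
  -- expand the block and collect the divisors of `n`
  have hd₀smooth : d₀ ∈ N.smoothNumbers := Nat.mem_smoothNumbers_of_dvd (smoothPart_mem_smoothNumbers N n) hd₀m
  have hT : ∀ d', d' ∣ d₀ → d' ∈ n.divisors.filter (· ≤ D') := by
    intro d' hd'
    rw [Finset.mem_filter, Nat.mem_divisors]
    have hd₀0 : d₀ ≠ 0 := Nat.ne_zero_of_mem_smoothNumbers hd₀smooth
    exact ⟨⟨hd'.trans (hd₀m.trans hmn), hn⟩, (Nat.le_of_dvd (Nat.pos_of_ne_zero hd₀0) hd').trans hd₀D⟩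
  calc ‖betaAF χ N s n‖ ≤ Real.exp (expSum (bExp s) m) := norm_betaAF_le_exp_expSum χ hχ R hs hn
    _ ≤ Real.exp (expSum (bExp s) d₀) ^ (J * 4 ^ (J - 1)) := hblock
    _ ≤ ∑ d ∈ n.divisors.filter (· ≤ D'), vMaj s (J * 4 ^ (J - 1)) N d :=
        exp_expSum_pow_le_sum_vMaj hs hd₀smooth hT

end Literature.Barriers.Parity.TaoTeravainen
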